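import Mathlib
import Summits.Ventures.PercRepro.TriangleCapSevenElevenB

/-!
# PercRepro — towards the cell `(7, 11)`: two triangles sharing a vertex, no outer vertex, a vertex off
`S` with two neighbours in `S`: `Σ_{codeg = 0} deficit ≥ 6` (p3, gen 35; part 35i)

* `two_pairs_le_sum_codeg_zero` — two `codeg = 0` pairs `(r, y₁)`, `(r, y₂)`, `y₁ ≠ y₂`: `Σ₀ ≥ 2 d₁ + 2 d₂`;
* `six_le_sum_codeg_zero'` — three `codeg = 0` pairs at `r` with distinct other ends and positive deficits:
  `Σ₀ ≥ 6`;
* **`six_le_of_bowtie_two_nbrs`** — triangles `u v w` and `u b c`, every triangle vertex in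
  `S = {u, v, w, b, c}`, no outer vertex for either, `k ≥ 7`, and a vertex `r ∉ S` adjacent to two distinct
  vertices of `S`: they are one of `v, w` and one of `b, c`; with a second vertex `r′ ∉ S`: if `r ~ r′` the
  pair `(r, r′)` is a third far pair at `r` (it misses `u`, or a vertex of `{v, w}` when `r′` hangs on `u`);
  if `r ≁ r′` and `r′` hangs on `u` then `r′` lies in both deficits at `r` (`2·2 + 2·2`); otherwise `r′` has
  its own neighbour in `{v, w}` and the pair `(r′, ·)` is the third.

Axioms: standard.
-/

namespace PercRepro

namespace TriangleCap

namespace C047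

open Finset

variable {V : Type*} [Fintype V] [DecidableEq V]

/-- Two `codeg = 0` pairs at `r` with distinct other ends: `Σ_{codeg = 0} deficit ≥ 2 d₁ + 2 d₂`. -/
theorem two_pairs_le_sum_codeg_zero (D : SimpleGraph V) [DecidableRel D.Adj] {r y₁ y₂ : V} (h12 : y₁ ≠ y₂)
    (hry₁ : D.Adj r y₁) (hry₂ : D.Adj r y₂) (hc₁ : codeg D (r, y₁) = 0) (hc₂ : codeg D (r, y₂) = 0) :
    2 * deficit D (r, y₁) + 2 * deficit D (r, y₂) ≤
      ∑ p ∈ adjPairsAll D, (if codeg D p = 0 then deficit D p else 0) := by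
  set P : Finset (V × V) := {(r, y₁), (y₁, r), (r, y₂), (y₂, r)} with hP
  have hsub : P ⊆ adjPairsAll D := by
    intro p hp
    rw [hP] at hp
    simp only [mem_insert, mem_singleton] at hp
    rw [mem_adjPairsAll]
    rcases hp with rfl | rfl | rfl | rfl
    · exact hry₁
    · exact hry₁.symm
    · exact hry₂
    · exact hry₂.symm
  have hc₁' : codeg D (y₁, r) = 0 := by rw [codeg_comm]; exact hc₁
  have hc₂' : codeg D (y₂, r) = 0 := by rw [codeg_comm]; exact hc₂
  have h1 : (r, y₁) ∉ ({(y₁, r), (r, y₂), (y₂, r)} : Finset (V × V)) := by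
    simp [hry₁.ne, hry₁.ne.symm, h12]
  have h2 : (y₁, r) ∉ ({(r, y₂), (y₂, r)} : Finset (V × V)) := by simp [hry₁.ne.symm, h12]
  have h3 : (r, y₂) ∉ ({(y₂, r)} : Finset (V × V)) := by simp [hry₂.ne]
  calc 2 * deficit D (r, y₁) + 2 * deficit D (r, y₂)
      = ∑ p ∈ P, (if codeg D p = 0 then deficit D p else 0) := by
        rw [hP, sum_insert h1, sum_insert h2, sum_insert h3, sum_singleton, if_pos hc₁, if_pos hc₁',
          if_pos hc₂, if_pos hc₂', deficit_comm D r y₁, deficit_comm D r y₂]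
        ring
    _ ≤ ∑ p ∈ adjPairsAll D, (if codeg D p = 0 then deficit D p else 0) := sum_le_sum_of_subset hsub

/-- Two vertices off a triangle miss a common vertex of it — with the vertex named. -/
theorem exists_nonadj_of_triangle' (D : SimpleGraph V) [DecidableRel D.Adj] (hK : K4mFree D) {p q s : V}
    (hpq : D.Adj p q) (hps : D.Adj p s) (hqs : D.Adj q s) {r y : V} (hr : ¬ (r = p ∨ r = q ∨ r = s))
    (hy : ¬ (y = p ∨ y = q ∨ y = s)) : ∃ z, (z = p ∨ z = q ∨ z = s) ∧ ¬ D.Adj r z ∧ ¬ D.Adj y z := by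
  obtain ⟨h1, h2, h3⟩ := at_most_one_of_triangle D hK hpq hps hqs hr
  obtain ⟨g1, g2, g3⟩ := at_most_one_of_triangle D hK hpq hps hqs hy
  by_cases hrp : D.Adj p r <;> by_cases hrq : D.Adj q r <;> by_cases hrs : D.Adj s r <;>
    by_cases hyp : D.Adj p y <;> by_cases hyq : D.Adj q y <;> by_cases hys : D.Adj s y
  all_goals first
    | exact (h1 ⟨hrp, hrq⟩).elim
    | exact (h2 ⟨hrp, hrs⟩).elim
    | exact (h3 ⟨hrq, hrs⟩).elim
    | exact (g1 ⟨hyp, hyq⟩).elim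
    | exact (g2 ⟨hyp, hys⟩).elim
    | exact (g3 ⟨hyq, hys⟩).elim
    | exact ⟨p, Or.inl rfl, fun h => hrp h.symm, fun h => hyp h.symm⟩
    | exact ⟨q, Or.inr (Or.inl rfl), fun h => hrq h.symm, fun h => hyq h.symm⟩
    | exact ⟨s, Or.inr (Or.inr rfl), fun h => hrs h.symm, fun h => hys h.symm⟩

/-- Three `codeg = 0` pairs at `r` with distinct other ends and positive deficits: `Σ₀ ≥ 6`. -/
theorem six_le_sum_codeg_zero' (D : SimpleGraph V) [DecidableRel D.Adj] {r y₁ y₂ y₃ : V} (h12 : y₁ ≠ y₂)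
    (h13 : y₁ ≠ y₃) (h23 : y₂ ≠ y₃) (hry₁ : D.Adj r y₁) (hry₂ : D.Adj r y₂) (hry₃ : D.Adj r y₃)
    (hc₁ : codeg D (r, y₁) = 0) (hc₂ : codeg D (r, y₂) = 0) (hc₃ : codeg D (r, y₃) = 0)
    (hd₁ : 1 ≤ deficit D (r, y₁)) (hd₂ : 1 ≤ deficit D (r, y₂)) (hd₃ : 1 ≤ deficit D (r, y₃)) :
    6 ≤ ∑ p ∈ adjPairsAll D, (if codeg D p = 0 then deficit D p else 0) := by
  set P : Finset (V × V) := {(r, y₁), (y₁, r), (r, y₂), (y₂, r), (r, y₃), (y₃, r)} with hP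
  have hsub : P ⊆ adjPairsAll D := by
    intro q hq
    rw [hP] at hq
    simp only [mem_insert, mem_singleton] at hq
    rw [mem_adjPairsAll]
    rcases hq with rfl | rfl | rfl | rfl | rfl | rfl
    · exact hry₁
    · exact hry₁.symm
    · exact hry₂
    · exact hry₂.symm
    · exact hry₃
    · exact hry₃.symm
  have hc₁' : codeg D (y₁, r) = 0 := by rw [codeg_comm]; exact hc₁
  have hc₂' : codeg D (y₂, r) = 0 := by rw [codeg_comm]; exact hc₂
  have hc₃' : codeg D (y₃, r) = 0 := by rw [codeg_comm]; exact hc₃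
  have hd₁' : 1 ≤ deficit D (y₁, r) := by rw [deficit_comm]; exact hd₁
  have hd₂' : 1 ≤ deficit D (y₂, r) := by rw [deficit_comm]; exact hd₂
  have hd₃' : 1 ≤ deficit D (y₃, r) := by rw [deficit_comm]; exact hd₃
  have hpos : ∀ q ∈ P, 1 ≤ (if codeg D q = 0 then deficit D q else 0) := by
    intro q hq
    rw [hP] at hq
    simp only [mem_insert, mem_singleton] at hq
    rcases hq with rfl | rfl | rfl | rfl | rfl | rfl
    · rw [if_pos hc₁]; exact hd₁
    · rw [if_pos hc₁']; exact hd₁'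
    · rw [if_pos hc₂]; exact hd₂
    · rw [if_pos hc₂']; exact hd₂'
    · rw [if_pos hc₃]; exact hd₃
    · rw [if_pos hc₃']; exact hd₃'
  have hcard : P.card = 6 := by
    rw [hP, card_insert_of_notMem, card_insert_of_notMem, card_insert_of_notMem,
      card_insert_of_notMem, card_insert_of_notMem, card_singleton]
    all_goals simp [hry₁.ne, hry₂.ne, hry₃.ne, hry₁.ne.symm, hry₂.ne.symm, hry₃.ne.symm, h12, h13, h23]
  calc 6 = ∑ _q ∈ P, 1 := by rw [sum_const, hcard]; rfl
    _ ≤ ∑ q ∈ P, (if codeg D q = 0 then deficit D q else 0) := sum_le_sum hpos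
    _ ≤ ∑ q ∈ adjPairsAll D, (if codeg D q = 0 then deficit D q else 0) := sum_le_sum_of_subset hsub

/-- **THE BOWTIE, NO OUTER VERTEX, A TWO-SIDED VERTEX OFF `S`:** `Σ_{codeg = 0} deficit ≥ 6` (`k ≥ 7`). -/
theorem six_le_of_bowtie_two_nbrs (D : SimpleGraph V) [DecidableRel D.Adj] (hK : K4mFree D)
    (hk : 7 ≤ Fintype.card V) {u v w b c : V}
    (huv : D.Adj u v) (huw : D.Adj u w) (hvw : D.Adj v w) (hub : D.Adj u b) (huc : D.Adj u c)
    (hbc : D.Adj b c) (hvb : v ≠ b) (hvc : v ≠ c) (hwb : w ≠ b) (hwc : w ≠ c)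
    (hS : ∀ x y z, D.Adj x y → D.Adj x z → D.Adj y z → x = u ∨ x = v ∨ x = w ∨ x = b ∨ x = c)
    (hO1 : outer D u v w = ∅) (hO2 : outer D u b c = ∅)
    {r y₁ y₂ : V} (hr : ¬ (r = u ∨ r = v ∨ r = w ∨ r = b ∨ r = c))
    (hy₁ : y₁ = u ∨ y₁ = v ∨ y₁ = w ∨ y₁ = b ∨ y₁ = c) (hy₂ : y₂ = u ∨ y₂ = v ∨ y₂ = w ∨ y₂ = b ∨ y₂ = c)
    (h12 : y₁ ≠ y₂) (hry₁ : D.Adj r y₁) (hry₂ : D.Adj r y₂) :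
    6 ≤ ∑ p ∈ adjPairsAll D, (if codeg D p = 0 then deficit D p else 0) := by
  have hr1 : ¬ (r = u ∨ r = v ∨ r = w) := by
    rintro (h | h | h) <;> exact hr (by simp [h])
  have hr2 : ¬ (r = u ∨ r = b ∨ r = c) := by
    rintro (h | h | h) <;> exact hr (by simp [h])
  have hno : ∀ x z, D.Adj r x → D.Adj r z → D.Adj x z → False :=
    fun x z h1 h2 h3 => hr (hS r x z h1 h2 h3)
  -- `r` is adjacent to at most one vertex of each triangle
  have hone1 : ∀ y z, (y = u ∨ y = v ∨ y = w) → (z = u ∨ z = v ∨ z = w) → y ≠ z → D.Adj r y →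
      D.Adj r z → False := fun y z hy hz hyz h1 h2 => not_adj_two_of_triangle D hK huv huw hvw hr1 hy hz hyz h1 h2
  have hone2 : ∀ y z, (y = u ∨ y = b ∨ y = c) → (z = u ∨ z = b ∨ z = c) → y ≠ z → D.Adj r y →
      D.Adj r z → False := fun y z hy hz hyz h1 h2 => not_adj_two_of_triangle D hK hub huc hbc hr2 hy hz hyz h1 h2
  -- the generic step: `y₁ ∈ {v, w}`, `y₂ ∈ {b, c}` (the other order is the same statement with the
  -- pairs swapped, handled at the end)
  have inner : ∀ y₁ y₂ : V, (y₁ = v ∨ y₁ = w) → (y₂ = b ∨ y₂ = c) → D.Adj r y₁ → D.Adj r y₂ →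
      6 ≤ ∑ p ∈ adjPairsAll D, (if codeg D p = 0 then deficit D p else 0) := by
    intro y₁ y₂ hy₁ hy₂ hry₁ hry₂
    have hy₁T1 : y₁ = u ∨ y₁ = v ∨ y₁ = w := by rcases hy₁ with rfl | rfl <;> simp
    have hy₂T2 : y₂ = u ∨ y₂ = b ∨ y₂ = c := by rcases hy₂ with rfl | rfl <;> simp
    have hy₁T2 : ¬ (y₁ = u ∨ y₁ = b ∨ y₁ = c) := by
      rcases hy₁ with rfl | rfl
      · rintro (h | h | h)
        · exact huv.ne h.symm
        · exact hvb h
        · exact hvc h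
      · rintro (h | h | h)
        · exact huw.ne h.symm
        · exact hwb h
        · exact hwc h
    have hy₂T1 : ¬ (y₂ = u ∨ y₂ = v ∨ y₂ = w) := by
      rcases hy₂ with rfl | rfl
      · rintro (h | h | h)
        · exact hub.ne h.symm
        · exact hvb h.symm
        · exact hwb h.symm
      · rintro (h | h | h)
        · exact huc.ne h.symm
        · exact hvc h.symm
        · exact hwc h.symm
    have h12 : y₁ ≠ y₂ := fun h => hy₁T2 (h ▸ hy₂T2)
    have hru : ¬ D.Adj r u := fun h => hone1 u y₁ (by simp) hy₁T1 (fun e => hy₁T2 (by simp [← e])) h hry₁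
    have hc₁ : codeg D (r, y₁) = 0 := codeg_eq_zero_of_no_triangle D hry₁ hno
    have hc₂ : codeg D (r, y₂) = 0 := codeg_eq_zero_of_no_triangle D hry₂ hno
    -- the far vertices of the other triangle
    obtain ⟨z₁, hz₁S, hz₁r, hz₁y⟩ := exists_nonadj_of_triangle' D hK hub huc hbc hr2 hy₁T2
    obtain ⟨z₂, hz₂S, hz₂r, hz₂y⟩ := exists_nonadj_of_triangle' D hK huv huw hvw hr1 hy₂T1
    have hd₁ : 1 ≤ deficit D (r, y₁) := one_le_deficit D hz₁r hz₁y
    have hd₂ : 1 ≤ deficit D (r, y₂) := one_le_deficit D hz₂r hz₂y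
    -- a second vertex off `S` and `r`
    obtain ⟨r', hr'⟩ := exists_not_six hk u v w b c r
    have hr'S : ¬ (r' = u ∨ r' = v ∨ r' = w ∨ r' = b ∨ r' = c) := by
      rintro (h | h | h | h | h) <;> exact hr' (by simp [h])
    have hr'r : r' ≠ r := fun h => hr' (by simp [h])
    have hr'1 : ¬ (r' = u ∨ r' = v ∨ r' = w) := by
      rintro (h | h | h) <;> exact hr' (by simp [h])
    have hr'2 : ¬ (r' = u ∨ r' = b ∨ r' = c) := by
      rintro (h | h | h) <;> exact hr' (by simp [h])
    have hno' : ∀ x z, D.Adj r' x → D.Adj r' z → D.Adj x z → False :=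
      fun x z h1 h2 h3 => hr'S (hS r' x z h1 h2 h3)
    by_cases hrr' : D.Adj r r'
    · -- the third pair `(r, r′)`
      have hc₃ : codeg D (r, r') = 0 := codeg_eq_zero_of_no_triangle D hrr' hno
      have hd₃ : 1 ≤ deficit D (r, r') := by
        by_cases hr'u : D.Adj u r'
        · -- `r′` hangs on `u`: it misses `v` and `w`; take the one that is not `y₁`
          have hr'v : ¬ D.Adj v r' := fun h =>
            not_adj_two_of_triangle D hK huv huw hvw hr'1 (by simp) (by simp) huv.ne hr'u.symm h.symm
          have hr'w : ¬ D.Adj w r' := fun h =>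
            not_adj_two_of_triangle D hK huv huw hvw hr'1 (by simp) (by simp) huw.ne hr'u.symm h.symm
          rcases hy₁ with rfl | rfl
          · -- `y₁ = v`: `w` is adjacent to neither `r` nor `r′`
            have hrw : ¬ D.Adj r w := fun h => hone1 y₁ w (by simp) (by simp) hvw.ne hry₁ h
            exact one_le_deficit D hrw (fun h => hr'w h.symm)
          · have hrv : ¬ D.Adj r v := fun h => hone1 y₁ v (by simp) (by simp) hvw.ne.symm hry₁ h
            exact one_le_deficit D hrv (fun h => hr'v h.symm)
        · exact one_le_deficit D hru (fun h => hr'u h.symm)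
      exact six_le_sum_codeg_zero' D h12 (fun h => hr'S (by rcases hy₁ with rfl | rfl <;> simp [← h]))
        (fun h => hr'S (by rcases hy₂ with rfl | rfl <;> simp [← h])) hry₁ hry₂ hrr' hc₁ hc₂ hc₃ hd₁ hd₂ hd₃
    · by_cases hr'u : D.Adj u r'
      · -- `r′` hangs on `u` and is far from `r`: it lies in both deficits at `r`
        have hr'y₁ : ¬ D.Adj y₁ r' := fun h =>
          not_adj_two_of_triangle D hK huv huw hvw hr'1 (by simp) hy₁T1
            (fun e => hy₁T2 (by simp [← e])) hr'u.symm h.symm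
        have hr'y₂ : ¬ D.Adj y₂ r' := fun h =>
          not_adj_two_of_triangle D hK hub huc hbc hr'2 (by simp) hy₂T2
            (fun e => hy₂T1 (by simp [← e])) hr'u.symm h.symm
        have hd₁' : 2 ≤ deficit D (r, y₁) := by
          unfold deficit
          refine le_trans ?_ (card_le_card (show ({z₁, r'} : Finset V) ⊆
            univ.filter (fun x => ¬ D.Adj r x ∧ ¬ D.Adj y₁ x) from ?_))
          · rw [card_pair]
            intro h
            exact hr'2 (h ▸ hz₁S)
          · intro x hx
            simp only [mem_insert, mem_singleton] at hx
            simp only [mem_filter, mem_univ, true_and]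
            rcases hx with rfl | rfl
            · exact ⟨hz₁r, hz₁y⟩
            · exact ⟨hrr', hr'y₁⟩
        have hd₂' : 2 ≤ deficit D (r, y₂) := by
          unfold deficit
          refine le_trans ?_ (card_le_card (show ({z₂, r'} : Finset V) ⊆
            univ.filter (fun x => ¬ D.Adj r x ∧ ¬ D.Adj y₂ x) from ?_))
          · rw [card_pair]
            intro h
            exact hr'1 (h ▸ hz₂S)
          · intro x hx
            simp only [mem_insert, mem_singleton] at hx
            simp only [mem_filter, mem_univ, true_and]
            rcases hx with rfl | rfl
            · exact ⟨hz₂r, hz₂y⟩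
            · exact ⟨hrr', hr'y₂⟩
        have := two_pairs_le_sum_codeg_zero D h12 hry₁ hry₂ hc₁ hc₂
        omega
      · -- `r′` has its own neighbour in `{v, w}`: the third pair
        have hr'O1 : r' ∉ outer D u v w := by rw [hO1]; exact notMem_empty r'
        obtain ⟨y₁', hy₁', hr'y₁'⟩ : ∃ y, (y = v ∨ y = w) ∧ D.Adj r' y := by
          rcases adj_of_not_outer D hr'O1 with h | h | h
          · exact (hr'u h).elim
          · exact ⟨v, Or.inl rfl, h.symm⟩
          · exact ⟨w, Or.inr rfl, h.symm⟩
        have hy₁'T2 : ¬ (y₁' = u ∨ y₁' = b ∨ y₁' = c) := by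
          rcases hy₁' with rfl | rfl
          · rintro (h | h | h)
            · exact huv.ne h.symm
            · exact hvb h
            · exact hvc h
          · rintro (h | h | h)
            · exact huw.ne h.symm
            · exact hwb h
            · exact hwc h
        have hc₃ : codeg D (r', y₁') = 0 := codeg_eq_zero_of_no_triangle D hr'y₁' hno'
        obtain ⟨z₃, hz₃r, hz₃y⟩ := exists_nonadj_of_triangle D hK hub huc hbc hr'2 hy₁'T2
        have hd₃ : 1 ≤ deficit D (r', y₁') := one_le_deficit D hz₃r hz₃y
        exact six_le_sum_codeg_zero D h12 hr'r
          (fun h => hr (by rcases hy₁' with rfl | rfl <;> simp [← h])) hry₁ hry₂ hr'y₁' hc₁ hc₂ hc₃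
          hd₁ hd₂ hd₃
  -- `y₁, y₂` are one of `v, w` and one of `b, c`
  have hnu₁ : y₁ ≠ u := by
    rintro rfl
    rcases hy₂ with h | h | h | h | h
    · exact h12 h.symm
    · exact hone1 y₁ y₂ (by simp) (by simp [h]) h12 hry₁ hry₂
    · exact hone1 y₁ y₂ (by simp) (by simp [h]) h12 hry₁ hry₂
    · exact hone2 y₁ y₂ (by simp) (by simp [h]) h12 hry₁ hry₂
    · exact hone2 y₁ y₂ (by simp) (by simp [h]) h12 hry₁ hry₂
  have hnu₂ : y₂ ≠ u := by
    rintro rfl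
    rcases hy₁ with h | h | h | h | h
    · exact h12 h
    · exact hone1 y₁ y₂ (by simp [h]) (by simp) h12 hry₁ hry₂
    · exact hone1 y₁ y₂ (by simp [h]) (by simp) h12 hry₁ hry₂
    · exact hone2 y₁ y₂ (by simp [h]) (by simp) h12 hry₁ hry₂
    · exact hone2 y₁ y₂ (by simp [h]) (by simp) h12 hry₁ hry₂
  rcases hy₁ with h1 | h1 | h1 | h1 | h1
  · exact (hnu₁ h1).elim
  · rcases hy₂ with h2 | h2 | h2 | h2 | h2
    · exact (hnu₂ h2).elim
    · exact (hone1 y₁ y₂ (by simp [h1]) (by simp [h2]) h12 hry₁ hry₂).elim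
    · exact (hone1 y₁ y₂ (by simp [h1]) (by simp [h2]) h12 hry₁ hry₂).elim
    · exact inner y₁ y₂ (Or.inl h1) (Or.inl h2) hry₁ hry₂
    · exact inner y₁ y₂ (Or.inl h1) (Or.inr h2) hry₁ hry₂
  · rcases hy₂ with h2 | h2 | h2 | h2 | h2
    · exact (hnu₂ h2).elim
    · exact (hone1 y₁ y₂ (by simp [h1]) (by simp [h2]) h12 hry₁ hry₂).elim
    · exact (hone1 y₁ y₂ (by simp [h1]) (by simp [h2]) h12 hry₁ hry₂).elim
    · exact inner y₁ y₂ (Or.inr h1) (Or.inl h2) hry₁ hry₂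
    · exact inner y₁ y₂ (Or.inr h1) (Or.inr h2) hry₁ hry₂
  · rcases hy₂ with h2 | h2 | h2 | h2 | h2
    · exact (hnu₂ h2).elim
    · exact inner y₂ y₁ (Or.inl h2) (Or.inl h1) hry₂ hry₁
    · exact inner y₂ y₁ (Or.inr h2) (Or.inl h1) hry₂ hry₁
    · exact (hone2 y₁ y₂ (by simp [h1]) (by simp [h2]) h12 hry₁ hry₂).elim
    · exact (hone2 y₁ y₂ (by simp [h1]) (by simp [h2]) h12 hry₁ hry₂).elim
  · rcases hy₂ with h2 | h2 | h2 | h2 | h2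
    · exact (hnu₂ h2).elim
    · exact inner y₂ y₁ (Or.inl h2) (Or.inr h1) hry₂ hry₁
    · exact inner y₂ y₁ (Or.inr h2) (Or.inr h1) hry₂ hry₁
    · exact (hone2 y₁ y₂ (by simp [h1]) (by simp [h2]) h12 hry₁ hry₂).elim
    · exact (hone2 y₁ y₂ (by simp [h1]) (by simp [h2]) h12 hry₁ hry₂).elim

end C047

end TriangleCap

end PercRepro
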